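import Summits.BirchSwinnertonDyer.BirchSwinnertonDyer.Theorems.SignedLowerHalvesKobayashiLowerHalfLargeImageKuriharaRigidityThm74Odd
import Summits.BirchSwinnertonDyer.Rank1Residual.Supersingular.KobayashiMainConjectureX7FouquetWan
import HarnessLib

/-!
# The Fouquet–Wan road of crux `KobayashiLowerHalfLargeImage` with Kobayashi 7.4 IN THE KERNEL: the composite binder
# «FW Thm. 5.1 ∘ Kobayashi 7.4» (`FouquetWan2021_thm51_via_kobayashi74_OPEN`) DERIVED from Fouquet–Wan Thm. 5.1
# read on the `η = 1` package (route `SignedLowerHalves`, item stmt-BirchSwinnertonDyer-19001; cell `bsd-ssimc`,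
# seat `bsd-line-slh-p1-w2` g2; `--supports … --as helper`)

WHAT. The accepted binder `FouquetWan2021_thm51_via_kobayashi74_OPEN`
(`Rank1Residual/Supersingular/KobayashiMainConjectureX7FouquetWan.lean`; consumers: `X7.kobayashiLowerDivisibility_of_thm51_OPEN`
= crux 3 on the Fouquet–Wan locus of X7 in either rank, the birth skeleton's `stub_fwLocus`, the lead's FW-locus
reading of `stub_three` at `p = 3`) is the conjunction «Fouquet–Wan arXiv:2107.13726 Thm. 5.1 (PREPRINT) ∘ Kobayashi
2003 Thm. 7.4 (PUBLISHED)», "stated in the tree's ± currency because no Kato-main-conjecture predicate for `E`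
exists in the tree" (its docstring, 2026-08-26). Since then the ACCEPTED `η = 1` Coleman/Kato package
(`Kobayashi2003.SignedColemanKatoData`) gives that predicate a home — the frame on which the tree reads Kim 2026
Thm. 1.11 (p607903) and Castella–Sano Thm. 1 (p607905, p611225) — and Kobayashi's Thm. 7.4 (ii) is a KERNEL theorem on
it at every odd good prime (this seat g0: `…KuriharaRigidityThm74`, `5 ≤ p`; the lead g2: `…KuriharaRigidityThm74Odd`,
p612293, `p ≠ 2` with the `p = 3` period fact). THIS FILE: `fouquetWan2021_thm51_via_kobayashi74_OPEN_of_katoFrame`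
derives the composite from FW Thm. 5.1 READ ON THE PACKAGE — displayed hypothesis `hFW` = VERBATIM the body of the
Literature statement `FouquetWan2021.thm51_katoMainIdentity_OPEN` (proposed with this file, p612468) — plus
Kobayashi Thm. 1.2 and the two period facts, by the lead's odd-`p` kernel Thm. 7.4. Net: on the FW road too,
Kobayashi 7.4 is no longer on faith; the road's unrefereed input is FW Thm. 5.1 ALONE, stated on Kato's objects.

HONEST FRAMING (cell `bsd-ssimc`, HOME `run/shared/lean/pub/bsd-ssimc/`; D-0036/D-0074): TOOL THEOREM ONLY — no
definition, no named fact minted, no `sorry`, axioms standard; CONDITIONAL on the displayed `hFW` (a PREPRINT claim,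
never a theorem), `h12`, `h5`, `h3`; the class-wide crux, the FW binder's preprint status, the line's stubs and the
route are NOT closed or changed; nothing is booked; BSD is not proved by any of this.
`--supports stmt-BirchSwinnertonDyer-19001 --as helper`.

References: [FouquetWan2021] Conj. 1.5 (= Kato Conj. 12.10), Thm. 5.1 (p. 53); [Kobayashi2003] Thm. 1.2, Thm.
6.2/6.3 (p. 11), Thm. 7.3 (7.21), Thm. 7.4 and its proof (p. 13); [Kato2004Asterisque] §12.2, Thm. 12.4–12.6, Conj.
12.10; [GreenbergVatsal2000] §3 Rem. 3.4; [Mazur1978] Cor. 4.1.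
-/

set_option autoImplicit false
-- single-problem summit (D-0017): the doubled namespace component is by design
set_option linter.dupNamespace false

noncomputable section

open scoped Classical MatrixGroups ModularForm

open CongruenceSubgroup Field WeierstrassCurve Literature.NumberTheory.EllipticCurves
  Literature.NumberTheory.EllipticCurves.ModularForms Literature.NumberTheory.GaloisRepresentations
  Literature.NumberTheory.EllipticCurves.Rank1Residual Summit.BirchSwinnertonDyer.Rank1Residual.Supersingular

namespace Summit.BirchSwinnertonDyer.BirchSwinnertonDyer.Theorems.KuriharaRigidity


/-! ## The FW-locus road: «Fouquet–Wan Thm. 5.1 ∘ Kobayashi 7.4» DERIVED from FW Thm. 5.1 on the package -/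

/-- **`FouquetWan2021_thm51_via_kobayashi74_OPEN` DERIVED.** Displayed hypothesis `hFW` = VERBATIM the body of
the Literature statement `FouquetWan2021.thm51_katoMainIdentity_OPEN` (Fouquet–Wan arXiv:2107.13726, PREPRINT,
Thm. 5.1 for `f = f_E` at a good odd `p` with `a_p = 0`: `E[p]` irreducible and a NON-SPLIT multiplicative prime
`ℓ ≠ p` with `p ∤ ord_ℓ(Δ_min)` ⟹ Kato's main identity (their (ConjIMC) = Kato Conj. 12.10) read on the `η = 1`
package for every sign — NEVER a theorem); `h12` = Kobayashi Thm. 1.2; `h5`, `h3` = the period comparisons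
`Ω(W) = u·Ω⁺_f`, `|u|_p = 1` at `p ≥ 5` (Mazur + Greenberg–Vatsal) and `p = 3`. CONCLUSION: the accepted
composite binder, its Kobayashi-7.4 half now the lead's kernel step `kobayashiMainConjecture_of_katoMainConjectureFrame_odd`
(`…KuriharaRigidityThm74Odd`, p612293) at every odd `p`, on the frame supplied by `hFW`. CONDITIONAL on `hFW` (PREPRINT claim), `h12`, `h5`, `h3`; closes nothing.
[claim: FouquetWan2021, status: under-review] [cite: Kobayashi2003, Thm. 7.4 (p. 13), Thm. 1.2 (p. 2)]
[cite: GreenbergVatsal2000, §3, Remark 3.4] [cite: Mazur1978, Cor. 4.1] -/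
theorem fouquetWan2021_thm51_via_kobayashi74_OPEN_of_katoFrame
    (hFW : ∀ (W : WeierstrassCurve ℚ) [W.IsElliptic] [W.IsGloballyMinimal] (p : ℕ) [Fact p.Prime]
        [ContinuousSMul ℤ_[p] (W.tateModule p)] [Module.Free ℤ_[p] (W.tateModule p)]
        [Module.Finite ℤ_[p] (W.tateModule p)]
        {N : ℕ} [NeZero N] (f : CuspForm (Gamma0 N) 2) (ϖ : ℚ)
        (κ : ZpExtension ℚ p) (γ : absoluteGaloisGroup ℚ),
        p ≠ 2 → W.HasGoodReductionAtPrime p → W.frobeniusTrace p = 0 → IsNewformOf W f →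
        (ϖ : ℝ) * W.realPeriodRat = plusPeriod f →
        κ.IsCyclotomic → κ.IsTopGenerator γ → IsCyclotomicVariable p γ →
        W.HasIrreducibleModPGaloisRep p →
        (∃ (ℓ : ℕ) (_ : Fact ℓ.Prime), ℓ ≠ p ∧ W.HasMultiplicativeReductionAtPrime ℓ ∧
          ¬ W.HasSplitMultiplicativeReductionAtPrime ℓ ∧ ¬ p ∣ padicValInt ℓ W.minimalDiscriminantInt) →
      ∀ (ε : ℤˣ) (I : Kato2004.IwasawaH1Data W p κ γ) (Y : W.FineSelmerDualData κ γ),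
        ∃ d : Kobayashi2003.SignedColemanKatoData W p f ϖ κ γ ε I,
          Module.charIdeal (IwasawaAlgebra p) Y.X =
            Module.charIdeal (IwasawaAlgebra p) (I.H ⧸ d.Z))
    (h12 : Kobayashi2003.thm12_signedSelmerDual_finite_torsion)
    (h5 : realPeriodRat_eq_unit_mul_plusPeriod) (h3 : realPeriodRat_eq_unit_mul_plusPeriod_three) :
    FouquetWan2021_thm51_via_kobayashi74_OPEN := by
  intro W _ _ p _ hp2 hgood hap hirr hFWℓ ε
  haveI : ContinuousSMul ℤ_[p] (W.tateModule p) := TateModule.continuousSMul_padicInt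
  haveI : Module.Free ℤ_[p] (W.tateModule p) := W.module_free_tateModule_holds p
  haveI : Module.Finite ℤ_[p] (W.tateModule p) := W.module_finite_tateModule_holds p
  refine kobayashiMainConjecture_of_katoMainConjectureFrame_odd W p h12 h5 h3 hp2 hgood hap hirr ε ?_
  intro κ γ hκ hγ hγc _ f hf ϖ hϖ I Y
  exact hFW W p f ϖ κ γ hp2 hgood hap hf hϖ hκ hγ hγc hirr hFWℓ ε I Y

end Summit.BirchSwinnertonDyer.BirchSwinnertonDyer.Theorems.KuriharaRigidity

end
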